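import Summits.RiemannHypothesis.RiemannHypothesis.Theorems.GroundBartaEvenWinsBeyondArchDeflationM75AssemblyE3
import Summits.RiemannHypothesis.RiemannHypothesis.Theorems.GroundBartaEvenWinsBeyondArchDeflationCertBridgeSigma
import Summits.RiemannHypothesis.RiemannHypothesis.Theorems.GroundBartaEvenWinsBeyondArchDeflationPSDFromBounds
import Summits.RiemannHypothesis.RiemannHypothesis.Theorems.WeilGroundStateGroundStateSimpleEvenTrialUpperFConst
import Summits.RiemannHypothesis.RiemannHypothesis.Theorems.WeilTwoPrimeDeflM75YCert
import Literature.NumberTheory.LFunctions.WeilDeflationPenaltyPolyEval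
import Summits.RiemannHypothesis.RiemannHypothesis.Theorems.GroundBartaEvenWinsBeyondArchDeflationM72Final
import HarnessLib

/-!
# RiemannHypothesis / GroundBarta — rung 4 (`EvenWinsBeyondArch`, stmt-RiemannHypothesis-18807 / 18085):
# the deflated Temple L-side at `c = 3/4` — the final inequality `λ ≤ ε_od(3/4)` modulo the sigma data

Helper file (`--supports`), RH-free.  Prover A, speedrun unit `sr-gb-rung-a` (gen 2).  Generated by `cert/abgen/gen_final.py`.

`dt_m75_oddLower_of_sigma`: from the deflated two-prime certificate M75Y (`deflBound_weilCertDeflM75Y`: `β₂₃ = 17/25`,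
`a₀ = 3/4`, six odd dyadic penalties), the certified A-layer matrix (`m75_A_mem`, `m75_inner`, file …M75Assembly), the
`log 2` bracket `tuf_log_two_bounds`, and — as HYPOTHESES — prover B's residual norm bounds `s_i` (sigma criterion) with
weights `θ`, budget `τ`, and a kernel PSD certificate (`nCheck₂` + scaled LDL data) for `(β−λ)(A−λG) − τ diag θ`:
`λ ≤ ε_od(3/4)`.  The trial vectors of the bridge are `v_i = 𝟙·maskPoly(r_i)`; `m75_mask` identifies them with
`m75v i = 𝟙·P_i(x/b)` (trimmed coefficient lists, `maskPoly_eq_poly_eval_of_trim`).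
-/

set_option linter.dupNamespace false

noncomputable section

open MeasureTheory Set
open scoped BigOperators ComplexConjugate

namespace Summit.RiemannHypothesis.RiemannHypothesis.Theorems.EvenWinsBeyondArch

open Literature.NumberTheory.LFunctions Literature.Analysis.ValidatedNumerics.ExpPoly
open Literature.Analysis.ValidatedNumerics.PolyMP Literature.NumberTheory.LFunctions.WeilArchPanelsM75Y
open Summit.RiemannHypothesis.RiemannHypothesis.Theorems.OddSector (weilDirichletEnergy₂ weilPoleForm₂)
open Summit.RiemannHypothesis.RiemannHypothesis.Theorems.GroundStateSimpleEven (tuf_log_two_bounds)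

/-- The penalty list of certificate M75Y has six entries. [folklore] -/
theorem m75_Rlen : weilCertDeflM75YR.length = 6 := rfl

set_option maxHeartbeats 0 in
/-- The certificate's masked coefficient vectors are the trimmed data polynomials `P_i` padded with zeros. [folklore] -/
theorem m75_trim : ∀ i : Fin 6, (List.range 256).map (maskV (weilCertDeflM75YR.get (Fin.cast m75_Rlen.symm i))) =
    m75P i ++ List.replicate (256 - (m75P i).length) 0 := by
  decide +kernel

/-- Odd parities and non-negative weights of the penalties. [folklore] -/
theorem m75_Rodd : (∀ i : Fin weilCertDeflM75YR.length, (weilCertDeflM75YR.get i).2.1 % 2 = 1) ∧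
    (∀ i : Fin weilCertDeflM75YR.length, 0 ≤ (weilCertDeflM75YR.get i).1) := by
  constructor <;> decide

/-- **The bridge's trial vectors are the A-layer vectors**: `𝟙_{[-c,c]}·maskPoly(r_i, 256, 18/25) = m75v i`. [folklore] -/
theorem m75_mask (i : Fin 6) (x : ℝ) :
    (((Icc (-(3 / 4 : ℝ)) (3 / 4)).indicator (fun x ↦ maskPoly (weilCertDeflM75YR.get (Fin.cast m75_Rlen.symm i)) 256 (3 / 4) x) x
        : ℝ) : ℂ) = m75v i x := by
  unfold m75v
  rw [dt_wY_apply]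
  push_cast
  congr 1
  by_cases hx : x ∈ Icc (-(3 / 4 : ℝ)) (3 / 4)
  · rw [indicator_of_mem hx, indicator_of_mem (by simpa using hx), maskPoly_eq_poly_eval_of_trim _ _ (m75_trim i)]
  · rw [indicator_of_notMem hx, indicator_of_notMem (by simpa using hx)]

/-- The window image of `v_i` at `c = 3/4` (the bridge's `F_i`, stated for `m75v`). [folklore] -/
def m75F (i : Fin 6) (y : ℝ) : ℂ :=
  (Icc (-(3 / 4 : ℝ)) (3 / 4)).indicator (fun y ↦
      2 * (∫ x, m75v i x * (Real.cosh (x / 2) : ℂ)) * (Real.cosh (y / 2) : ℂ) -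
        2 * (∫ x, m75v i x * (Real.sinh (x / 2) : ℂ)) * (Real.sinh (y / 2) : ℂ) +
      (∑ m ∈ weilPrimeIndex (3 / 4 : ℝ), (((ArithmeticFunction.vonMangoldt m : ℝ) / Real.sqrt m : ℝ) : ℂ) *
        (2 * m75v i y - m75v i (y - Real.log m) - m75v i (y + Real.log m))) +
      ∫ t in Ioi 0, (weilArchDensity t : ℂ) * (2 * m75v i y - m75v i (y - t) - m75v i (y + t))) y -
    (weilMarkovConstant (3 / 4 : ℝ) : ℂ) * m75v i y

/-- **`λ ≤ ε_od(3/4)` modulo the sigma data.**  Prover B supplies `W`, `s`, `θ` (positive), the residual bounds `hs`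
for `m75v` / `m75F`, the budget `Σ s_i/θ_i ≤ τ`; the kernel PSD certificate (`nCheck₂` + scaled LDL data) is generated by
`cert/abgen/psdcert.py`. [cite: GoerischHaunhorst1985, §2] -/
theorem dt_m75_oddLower_of_sigma (W : Fin 6 → Fin 6 → ℝ) (s : Fin 6 → ℝ) (θq : Fin 6 → ℚ) (hθ : ∀ i, 0 < θq i)
    (hs : ∀ i, ∫ x, ‖(m75F i - ∑ l, W i l • m75v l) x‖ ^ 2 ≤ s i) (τ : ℚ) (hτ : ∑ i, s i / (θq i : ℝ) ≤ (τ : ℝ))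
    (lam : ℚ) (hlam : lam < m72βlo) {m : ℕ} (sc : Fin 6 → ℚ) (P E : Fin 6 → Fin 6 → ℚ) (D : Fin m → ℚ)
    (L : Fin m → Fin 6 → ℚ) (δ : ℚ) (hchk : nCheck₂ m72βlo m72βhi lam τ θq sc m75Alo m75Ahi m75G P E = true)
    (hrow : ∀ i, ∑ j, E i j ≤ δ) (hcol : ∀ j, ∑ i, E i j ≤ δ) (hD : ∀ r, 0 ≤ D r)
    (hP : ∀ i j, P i j = δ * (if i = j then 1 else 0) + ∑ r, D r * L r i * L r j) :
    (lam : ℝ) ≤ weilOddGroundEnergy (3 / 4 : ℝ) := by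
  have hc : (0 : ℝ) < 3 / 4 := by norm_num
  have hc5 : (3 / 4 : ℝ) ≤ Real.log 5 / 2 := by have := m75_le_log5; push_cast at this; linarith
  have hβ := m72_beta_mem
  have hlamR : (lam : ℝ) < 17 / 25 - Real.log 2 / 2 := by
    have : ((lam : ℚ) : ℝ) < ((m72βlo : ℚ) : ℝ) := by exact_mod_cast hlam
    linarith [hβ.1]
  -- the certificate conclusion in the bridge's form
  have hcert := fun (g : ℝ → ℂ) (hg : IsWeilTest g) (hsupp : tsupport g ⊆ Icc (-(3 / 4 : ℝ)) (3 / 4))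
      (hodd : ∀ x, g (-x) = -g x) ↦ deflBound_weilCertDeflM75Y hg hsupp hodd
  obtain ⟨hN1, ha0⟩ := params_weilCertDeflM75Y
  have hβ23 : ((weilCertDeflM75YBeta : ℚ) : ℝ) = 17 / 25 := by show (((17 / 25 : ℚ)) : ℝ) = _; norm_num
  simp only [hN1, ha0, hβ23] at hcert
  -- the A-layer hN
  have hA := m75_A_mem
  have hG := m75_inner
  have hN := dt_hN_of_bounds₂
    (fun i j ↦ weilPoleForm₂ (m75v i) (m75v j) + weilDirichletEnergy₂ (((3 / 4 : ℚ)) : ℝ) (m75v i) (m75v j) -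
      weilMarkovConstant (((3 / 4 : ℚ)) : ℝ) * ∫ x, (m75v i x * conj (m75v j x)).re)
    m75Alo m75Ahi m75G hA (fun i j ↦ ∫ x, (m75v i x * conj (m75v j x)).re) hG m72βlo m72βhi hβ lam τ θq sc P E D L δ
    hchk hrow hcol hD hP
  have h1825 : (((3 / 4 : ℚ)) : ℝ) = (3 / 4 : ℝ) := by norm_num
  simp only [h1825] at hN
  exact dt_weilOddGroundEnergy_ge_of_deflCert_sigma hc hc5 le_rfl weilCertDeflM75YR 256 m75_Rodd.1 m75_Rodd.2 hcert
    m75v m75F (fun i x ↦ (m75_mask i x).symm) (fun i y ↦ rfl) W hlamR s (fun i ↦ (θq i : ℝ))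
    (fun i ↦ by exact_mod_cast hθ i) hs hτ hN

end Summit.RiemannHypothesis.RiemannHypothesis.Theorems.EvenWinsBeyondArch

end
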